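import Literature.NumberTheory.ComplexMultiplication.EllipticUnits.DeShalitDivisionPointsLatticeConjugate
import HarnessLib

/-!
# An arbitrary `𝔭̄`-division point `ub` (`π₁·ub ∈ L`, `ub ∉ L`) and the translates `k·u_{N+1} + ub` on the model lattice `L = Ω·𝔣`
# — the lattice side conditions of the CM descent (N1) when `v̄ ∣ 𝔣` (de Shalit II.4.4 (iv) — proofs only)

Topic `NumberTheory/ComplexMultiplication/EllipticUnits` (theorems only; no definition, no named fact, no instance).  Cell `bsd-print-cf2`,
width seat `bsd-line-cf2-p1-w5` g17, piece B9 (N1)-lat (general form).  `DeShalitDivisionPointsLatticeConjugate` treats the `𝔭̄`-division point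
`ū = ι(β̄)Ω − Ω/ι(π₁)`, which needs `β̄π₁ ≡ 1 (mod 𝔣)`, i.e. `(π₁, 𝔣) = 1`.  In the lane the elliptic-unit modulus is `𝔣 = 𝔤·v̄²`, so `v̄ = (π₁)`
DIVIDES `𝔣` and that point is not available; a primitive `𝔭̄`-division point of `ℂ/L` is then `ub = Ω·ι(γ)` with `γ ∈ (𝔣 : v̄) ∖ 𝔣`.  Every lemma
of the companion file used only `π₁·ū ∈ L` and `ū ∉ L`; here they are restated for an ARBITRARY `ub : ℂ` with
`(hub1 : ι π₁ · ub ∈ L) (hub0 : ub ∉ L)` (data of the model lattice `hL`, `Ω ≠ 0`, `π₀ + π₁ = 1`, `2 = π₀π₁`, `βπ₀ ≡ 1 (mod 𝔣)`, `2^m ∉ 𝔣`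
as there; `u_n = ι(βⁿ)Ω − Ω/ι(π₀ⁿ)`):

* `two_mul_mem_of_mul_mem` (`2ub ∈ L`), `mul_sub_self_mem_of_mul_mem` (`π₀ub − ub ∈ L`), `mem_of_pow_mul_mem_of_mul_mem`;
* `two_pow_mul_nsmul_divisionPt_add_mem` (`2^{N+2}(k·u_{N+1} + ub) ∈ L`), `mem_of_pow_mul_nsmul_divisionPt_add_mem`,
  ★ `nsmul_divisionPt_add_notMem` (`k·u_{N+1} + ub ∉ L`), `mul_nsmul_divisionPt_add_notMem` (`π₀(…) ∉ L`),
  `base_add_nsmul_divisionPt_add_notMem` (`Ω + (…) ∉ L`), `mul_base_add_nsmul_divisionPt_add_notMem` (`π₀(Ω + …) ∉ L`),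
  ★ `mul_nsmul_divisionPt_add_add_two_mul_notMem` (the EXCLUSION `π₀(…) + 2π₀Ω ∉ L`), ★ `mul_nsmul_divisionPt_succ_add_sub_mem`
  (the CONGRUENCE `π₀(k·u_{N+2} + ub) − (k·u_{N+1} + ub) ∈ L`), `mul_nsmul_divisionPt_one_add_sub_mem` (`π₀(k·u₁ + ub) − ub ∈ L`).

No summit statement is proved; BSD is not proved by any of this.

## References
* [deShalit1987] E. de Shalit, *Iwasawa theory of elliptic curves with complex multiplication* (1987), II §4.2 (6), II §4.4 Definition, (iv).
* [SilvermanAEC2009] J. H. Silverman, *The Arithmetic of Elliptic Curves*, 2nd ed. (2009), Prop. VI.3.6 (b).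
-/

noncomputable section

open scoped Classical
open NumberField PeriodPair

namespace Literature.NumberTheory.ComplexMultiplication.EllipticUnits

variable {K : Type} [Field K] (ι : K →+* ℂ) {𝔣 : Ideal (𝓞 K)} {L : PeriodPair} {Ω : ℂ}
  (hL : ∀ z : ℂ, z ∈ L.lattice ↔ ∃ a ∈ 𝔣, z = Ω * ι (a : K)) {β π₀ π₁ : 𝓞 K}

/-- `c·z ∈ L` for `z ∈ L`, `c ∈ ℕ`. [folklore] -/
private theorem natMul_mem {z : ℂ} (h : z ∈ L.lattice) (c : ℕ) : (c : ℂ) * z ∈ L.lattice := by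
  have := L.lattice.smul_mem (c : ℤ) h
  simpa [zsmul_eq_mul] using this

/-- `2^m·z ∈ L` for `z ∈ L`. [folklore] -/
private theorem twoPow_mul_mem {z : ℂ} (h : z ∈ L.lattice) (m : ℕ) : (2 : ℂ) ^ m * z ∈ L.lattice := by
  simpa using natMul_mem h (2 ^ m)

/-! ## An ARBITRARY `𝔭̄`-division point `ub` (`π₁·ub ∈ L`, `ub ∉ L`) — the case `v̄ ∣ 𝔣`

When `v̄ = (π₁)` divides the lattice modulus `𝔣` (the lane's `𝔣 = 𝔤·v̄²`), `π₁` is not invertible modulo `𝔣` and the point `ι(β̄)Ω − Ω/ι(π₁)`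
of §1 is not available; a primitive `𝔭̄`-division point of `ℂ/L` is then `ub = Ω·ι(γ)` with `γ ∈ (𝔣 : v̄) ∖ 𝔣`.  The lemmas of §1–§2 only
used `π₁·ū ∈ L` and `ū ∉ L`, and are restated here for an arbitrary `ub : ℂ` with these two properties. -/

section General

variable {ub : ℂ}

include hL in
/-- `2·ub ∈ L` when `π₁·ub ∈ L` and `2 = π₀π₁`. [cite: deShalit1987, II §4.4 (iv)] -/
theorem two_mul_mem_of_mul_mem (hub1 : ι (π₁ : K) * ub ∈ L.lattice) (h2 : (2 : 𝓞 K) = π₀ * π₁) : (2 : ℂ) * ub ∈ L.lattice := by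
  have e : (2 : ℂ) = ι (π₀ : K) * ι (π₁ : K) := by
    have := two_pow_eq_of_split ι h2 1
    simpa [mul_comm] using this
  rw [e, mul_assoc]
  exact isCMLattice_of_model ι hL _ _ hub1

/-- `π₀·ub − ub = −π₁·ub ∈ L` (`π₀ + π₁ = 1`). [cite: deShalit1987, II §4.4 (iv)] -/
theorem mul_sub_self_mem_of_mul_mem (htr : π₀ + π₁ = 1) (hub1 : ι (π₁ : K) * ub ∈ L.lattice) :
    ι (π₀ : K) * ub - ub ∈ L.lattice := by
  have e : (π₀ : K) = 1 - (π₁ : K) := by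
    have h := congrArg (fun x : 𝓞 K => (x : K)) htr
    push_cast at h
    linear_combination h
  rw [e, map_sub, map_one, show ((1 : ℂ) - ι (π₁ : K)) * ub - ub = -(ι (π₁ : K) * ub) by ring]
  exact neg_mem hub1

include hL in
/-- `π₀^m·ub ∈ L ⟹ ub ∈ L` (`(π₀^m, π₁) = 1` from `π₀ + π₁ = 1`, and `π₁·ub ∈ L`). [cite: deShalit1987, II §4.4 (iv)] -/
theorem mem_of_pow_mul_mem_of_mul_mem (htr : π₀ + π₁ = 1) (hub1 : ι (π₁ : K) * ub ∈ L.lattice) (m : ℕ)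
    (h : ι ((π₀ ^ m : 𝓞 K) : K) * ub ∈ L.lattice) : ub ∈ L.lattice := by
  have hcop : IsCoprime (π₀ ^ m) π₁ := (IsCoprime.pow_left (m := m) ⟨1, 1, by linear_combination htr⟩)
  obtain ⟨a, b, hab⟩ := hcop
  have h1 := isCMLattice_of_model ι hL a _ h
  have h2 := isCMLattice_of_model ι hL b _ hub1
  have e : ub = ι (a : K) * (ι ((π₀ ^ m : 𝓞 K) : K) * ub) + ι (b : K) * (ι (π₁ : K) * ub) := by
    have hab' : (a : K) * ((π₀ ^ m : 𝓞 K) : K) + (b : K) * (π₁ : K) = 1 := by exact_mod_cast congrArg (fun x : 𝓞 K => (x : K)) hab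
    have hab'' := congrArg ι hab'
    rw [map_add, map_mul, map_mul, map_one] at hab''
    linear_combination -ub * hab''
  rw [e]
  exact add_mem h1 h2

variable {N k : ℕ}

include hL in
/-- `2^{N+2}·(k·u_{N+1} + ub) ∈ L` (`2^{N+1}u_{N+1} ∈ L`, `2ub ∈ L`). [cite: deShalit1987, II §4.4 (iv)] -/
theorem two_pow_mul_nsmul_divisionPt_add_mem (hβ : β * π₀ - 1 ∈ 𝔣) (hπ₀ : π₀ ≠ 0) (hub1 : ι (π₁ : K) * ub ∈ L.lattice)
    (h2 : (2 : 𝓞 K) = π₀ * π₁) (N k : ℕ) :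
    (2 : ℂ) ^ (N + 2) * ((k : ℂ) * (ι ((β ^ (N + 1) : 𝓞 K) : K) * Ω - Ω / ι ((π₀ ^ (N + 1) : 𝓞 K) : K)) + ub) ∈ L.lattice := by
  have h1 := natMul_mem (two_pow_mul_divisionPt_mem ι hL hβ hπ₀ h2 (N + 1)) (2 * k)
  have h2' := twoPow_mul_mem (two_mul_mem_of_mul_mem ι hL hub1 h2) (N + 1)
  have e : (2 : ℂ) ^ (N + 2) * ((k : ℂ) * (ι ((β ^ (N + 1) : 𝓞 K) : K) * Ω - Ω / ι ((π₀ ^ (N + 1) : 𝓞 K) : K)) + ub) =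
      ((2 * k : ℕ) : ℂ) * ((2 : ℂ) ^ (N + 1) * (ι ((β ^ (N + 1) : 𝓞 K) : K) * Ω - Ω / ι ((π₀ ^ (N + 1) : 𝓞 K) : K))) + (2 : ℂ) ^ (N + 1) * (2 * ub) := by
    push_cast; ring
  rw [e]
  exact add_mem h1 h2'

include hL in
/-- `π₀^{N+1}·(k·u_{N+1} + ub) ∈ L ⟹ ub ∈ L`. [cite: deShalit1987, II §4.4 (iv)] -/
theorem mem_of_pow_mul_nsmul_divisionPt_add_mem (htr : π₀ + π₁ = 1) (hβ : β * π₀ - 1 ∈ 𝔣) (hπ₀ : π₀ ≠ 0)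
    (hub1 : ι (π₁ : K) * ub ∈ L.lattice)
    (h : ι ((π₀ ^ (N + 1) : 𝓞 K) : K) * ((k : ℂ) * (ι ((β ^ (N + 1) : 𝓞 K) : K) * Ω - Ω / ι ((π₀ ^ (N + 1) : 𝓞 K) : K)) + ub) ∈ L.lattice) : ub ∈ L.lattice := by
  have h1 := natMul_mem (pow_mul_divisionPt_mem ι hL hβ hπ₀ (N + 1)) k
  refine mem_of_pow_mul_mem_of_mul_mem ι hL htr hub1 (N + 1) ?_
  have e : ι ((π₀ ^ (N + 1) : 𝓞 K) : K) * ub =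
      ι ((π₀ ^ (N + 1) : 𝓞 K) : K) * ((k : ℂ) * (ι ((β ^ (N + 1) : 𝓞 K) : K) * Ω - Ω / ι ((π₀ ^ (N + 1) : 𝓞 K) : K)) + ub) - (k : ℂ) * (ι ((π₀ ^ (N + 1) : 𝓞 K) : K) * (ι ((β ^ (N + 1) : 𝓞 K) : K) * Ω - Ω / ι ((π₀ ^ (N + 1) : 𝓞 K) : K))) := by ring
  rw [e]
  exact sub_mem h h1

include hL in
/-- ★ **`k·u_{N+1} + ub ∉ L`** (`ub ∉ L`). [cite: deShalit1987, II §4.4 (iv)] -/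
theorem nsmul_divisionPt_add_notMem (htr : π₀ + π₁ = 1) (hβ : β * π₀ - 1 ∈ 𝔣) (hπ₀ : π₀ ≠ 0)
    (hub1 : ι (π₁ : K) * ub ∈ L.lattice) (hub0 : ub ∉ L.lattice) :
    (k : ℂ) * (ι ((β ^ (N + 1) : 𝓞 K) : K) * Ω - Ω / ι ((π₀ ^ (N + 1) : 𝓞 K) : K)) + ub ∉ L.lattice := fun h =>
  hub0 (mem_of_pow_mul_nsmul_divisionPt_add_mem ι hL htr hβ hπ₀ hub1 (isCMLattice_of_model ι hL _ _ h))

include hL in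
/-- **`π₀·(k·u_{N+1} + ub) ∉ L`**. [cite: deShalit1987, II §4.4 (iv)] -/
theorem mul_nsmul_divisionPt_add_notMem (htr : π₀ + π₁ = 1) (hβ : β * π₀ - 1 ∈ 𝔣) (hπ₀ : π₀ ≠ 0)
    (hub1 : ι (π₁ : K) * ub ∈ L.lattice) (hub0 : ub ∉ L.lattice) :
    ι (π₀ : K) * ((k : ℂ) * (ι ((β ^ (N + 1) : 𝓞 K) : K) * Ω - Ω / ι ((π₀ ^ (N + 1) : 𝓞 K) : K)) + ub) ∉ L.lattice := by
  intro h
  refine hub0 (mem_of_pow_mul_nsmul_divisionPt_add_mem ι hL htr hβ hπ₀ hub1 (N := N) (k := k) ?_)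
  have h1 := isCMLattice_of_model ι hL (π₀ ^ N) _ h
  have e : ι ((π₀ ^ (N + 1) : 𝓞 K) : K) * ((k : ℂ) * (ι ((β ^ (N + 1) : 𝓞 K) : K) * Ω - Ω / ι ((π₀ ^ (N + 1) : 𝓞 K) : K)) + ub) = ι ((π₀ ^ N : 𝓞 K) : K) * (ι (π₀ : K) * ((k : ℂ) * (ι ((β ^ (N + 1) : 𝓞 K) : K) * Ω - Ω / ι ((π₀ ^ (N + 1) : 𝓞 K) : K)) + ub)) := by
    push_cast
    simp only [map_pow]
    ring
  rw [e]
  exact h1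

include hL in
/-- **`Ω + (k·u_{N+1} + ub) ∉ L`** under `2^m ∉ 𝔣`. [cite: deShalit1987, II §4.4 (iv)] -/
theorem base_add_nsmul_divisionPt_add_notMem (hΩ : Ω ≠ 0) (hβ : β * π₀ - 1 ∈ 𝔣) (hπ₀ : π₀ ≠ 0)
    (hub1 : ι (π₁ : K) * ub ∈ L.lattice) (h2 : (2 : 𝓞 K) = π₀ * π₁) (h𝔣 : ∀ m : ℕ, ((2 : 𝓞 K) ^ m : 𝓞 K) ∉ 𝔣) :
    Ω + ((k : ℂ) * (ι ((β ^ (N + 1) : 𝓞 K) : K) * Ω - Ω / ι ((π₀ ^ (N + 1) : 𝓞 K) : K)) + ub) ∉ L.lattice := by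
  intro h
  apply twoPow_mul_base_notMem ι hL hΩ h𝔣 (N + 2)
  have h1 := twoPow_mul_mem h (N + 2)
  have h2' := two_pow_mul_nsmul_divisionPt_add_mem ι hL hβ hπ₀ hub1 h2 N k
  have := sub_mem h1 h2'
  rwa [mul_add, add_sub_cancel_right] at this

include hL in
/-- **`π₀·(Ω + (k·u_{N+1} + ub)) ∉ L`** under `2^m ∉ 𝔣`, `2 = π₀π₁`. [cite: deShalit1987, II §4.4 (iv)] -/
theorem mul_base_add_nsmul_divisionPt_add_notMem (hΩ : Ω ≠ 0) (hβ : β * π₀ - 1 ∈ 𝔣) (hπ₀ : π₀ ≠ 0)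
    (hub1 : ι (π₁ : K) * ub ∈ L.lattice) (h2 : (2 : 𝓞 K) = π₀ * π₁) (h𝔣 : ∀ m : ℕ, ((2 : 𝓞 K) ^ m : 𝓞 K) ∉ 𝔣) :
    ι (π₀ : K) * (Ω + ((k : ℂ) * (ι ((β ^ (N + 1) : 𝓞 K) : K) * Ω - Ω / ι ((π₀ ^ (N + 1) : 𝓞 K) : K)) + ub)) ∉ L.lattice := by
  intro h
  apply twoPow_mul_gen_mul_base_notMem ι hL hΩ h𝔣 h2 (N + 2)
  have h1 := twoPow_mul_mem h (N + 2)
  have h2' := isCMLattice_of_model ι hL π₀ _ (two_pow_mul_nsmul_divisionPt_add_mem ι hL hβ hπ₀ hub1 h2 N k)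
  have := sub_mem h1 h2'
  convert this using 1
  ring

include hL in
/-- ★ **The exclusion `π₀·(k·u_{N+1} + ub) + 2π₀Ω ∉ L`** under `2^m ∉ 𝔣`, `2 = π₀π₁` — `hexcl` of `DivisionPointsLaneDescent`.
[cite: deShalit1987, II §4.4 (iv)] -/
theorem mul_nsmul_divisionPt_add_add_two_mul_notMem (hΩ : Ω ≠ 0) (hβ : β * π₀ - 1 ∈ 𝔣) (hπ₀ : π₀ ≠ 0)
    (hub1 : ι (π₁ : K) * ub ∈ L.lattice) (h2 : (2 : 𝓞 K) = π₀ * π₁) (h𝔣 : ∀ m : ℕ, ((2 : 𝓞 K) ^ m : 𝓞 K) ∉ 𝔣) :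
    ι (π₀ : K) * ((k : ℂ) * (ι ((β ^ (N + 1) : 𝓞 K) : K) * Ω - Ω / ι ((π₀ ^ (N + 1) : 𝓞 K) : K)) + ub) + 2 * (ι (π₀ : K) * Ω) ∉ L.lattice := by
  intro h
  apply twoPow_mul_gen_mul_base_notMem ι hL hΩ h𝔣 h2 (N + 3)
  have h1 := twoPow_mul_mem h (N + 2)
  have h2' := isCMLattice_of_model ι hL π₀ _ (two_pow_mul_nsmul_divisionPt_add_mem ι hL hβ hπ₀ hub1 h2 N k)
  have := sub_mem h1 h2'
  convert this using 1
  ring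

include hL in
/-- ★ **The congruence `π₀·(k·u_{N+2} + ub) − (k·u_{N+1} + ub) ∈ L`**. [cite: deShalit1987, II §4.4 (iv)] -/
theorem mul_nsmul_divisionPt_succ_add_sub_mem (htr : π₀ + π₁ = 1) (hβ : β * π₀ - 1 ∈ 𝔣) (hπ₀ : π₀ ≠ 0)
    (hub1 : ι (π₁ : K) * ub ∈ L.lattice) (N k : ℕ) :
    ι (π₀ : K) * ((k : ℂ) * (ι ((β ^ (N + 2) : 𝓞 K) : K) * Ω - Ω / ι ((π₀ ^ (N + 2) : 𝓞 K) : K)) + ub) - ((k : ℂ) * (ι ((β ^ (N + 1) : 𝓞 K) : K) * Ω - Ω / ι ((π₀ ^ (N + 1) : 𝓞 K) : K)) + ub) ∈ L.lattice := by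
  have h1 := natMul_mem (mul_divisionPt_succ_sub_mem ι hL hβ hπ₀ (N + 1)) k
  have h2' := mul_sub_self_mem_of_mul_mem ι htr hub1
  convert add_mem h1 h2' using 1
  ring

include hL in
/-- **`π₀·(k·u₁ + ub) − ub ∈ L`** (`π₀u₁ ∈ L`, `π₀ub ≡ ub`). [cite: deShalit1987, II §4.4 (iv)] -/
theorem mul_nsmul_divisionPt_one_add_sub_mem (htr : π₀ + π₁ = 1) (hβ : β * π₀ - 1 ∈ 𝔣) (hπ₀ : π₀ ≠ 0)
    (hub1 : ι (π₁ : K) * ub ∈ L.lattice) (k : ℕ) :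
    ι (π₀ : K) * ((k : ℂ) * (ι ((β ^ (0 + 1) : 𝓞 K) : K) * Ω - Ω / ι ((π₀ ^ (0 + 1) : 𝓞 K) : K)) + ub) - ub ∈ L.lattice := by
  have h1 := natMul_mem (pow_mul_divisionPt_mem ι hL hβ hπ₀ (0 + 1)) k
  have h2' := mul_sub_self_mem_of_mul_mem ι htr hub1
  convert add_mem h1 h2' using 1
  push_cast
  ring

end General

end Literature.NumberTheory.ComplexMultiplication.EllipticUnits

end
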